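import Summits.KontsevichZagierPeriods.KontsevichZagierPeriods.Theorems.LinRedNormalFormArrangementNormalFormSeparateTwoHIChart

/-!
# Covering a punctured neighbourhood of a base point by finitely many thin sectors

(Line `janus-bands`, crux `ArrangementNormalForm`, stub `stub_separateTwoPos_hI`, part `HICover`.)
The globalisation step of the local analysis of the Taylor pieces at a point `z₁` of the base
plane, for the pole line direction of slope `l`. Two families of thin sectors (part `HIChart`)
are used, written in the sheared coordinates `ξ = x − x₁`, `μ = (y − y₁) − l ξ`:
* the VERTICAL sectors `sector z₁ (0, p) (q, q l) δ [0, ε)`, `p, q = ±1`, whose union is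
  `{0 < |μ| < δ, |ξ| < ε |μ|}` (`mem_vsector`);
* the sectors of SLOPE `r`: `sector z₁ (o ρ, o ρ (l + r)) (0, σ) δ [0, ε)`, `o, σ = ±1`, whose
  union is `{0 < |ξ| < ρ δ, |μ/ξ − r| < ε/ρ}` (`mem_hsector`).
`cover_nhds`: if a measure `ν` with `ν {z₁} = 0` is finite on the four vertical sectors for one
`(δ, ε)` and, for EVERY slope `r`, on the four sectors of slope `r` for some `(ρ, δ, ε)`, then
`ν` is finite on a neighbourhood of `z₁` (compactness of the slope interval `[-1/ε, 1/ε]`).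
-/

noncomputable section

open Set MeasureTheory Filter Topology
open scoped ENNReal

namespace Summit.KontsevichZagierPeriods.ArrangementNormalForm.JanusBands

namespace SepTwo

/-- Every real is `±1` times its absolute value. -/
theorem exists_pm_mul_abs (c : ℝ) : ∃ p ∈ ({1, -1} : Finset ℝ), p * |c| = c := by
  rcases le_or_gt 0 c with h | h
  · exact ⟨1, by simp, by rw [abs_of_nonneg h, one_mul]⟩
  · exact ⟨-1, by simp, by rw [abs_of_neg h]; ring⟩

/-- A real of absolute value `1` is `±1`. -/
theorem mem_pm_of_abs {x : ℝ} (hx : |x| = 1) : x ∈ ({1, -1} : Finset ℝ) := by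
  rcases (abs_eq zero_le_one).1 hx with h | h <;> simp [h]

/-- **Membership in a vertical sector.** A point with `0 < |μ| < δ` and `|ξ| < ε |μ|` lies in
the vertical sector of signs `p = sgn μ`, `q = sgn ξ`. -/
theorem mem_vsector (z₁ z : Fin 2 → ℝ) (l δ ε p q : ℝ)
    (hp : p * |z 1 - z₁ 1 - l * (z 0 - z₁ 0)| = z 1 - z₁ 1 - l * (z 0 - z₁ 0))
    (hq : q * |z 0 - z₁ 0| = z 0 - z₁ 0)
    (hμ0 : z 1 - z₁ 1 - l * (z 0 - z₁ 0) ≠ 0) (hμδ : |z 1 - z₁ 1 - l * (z 0 - z₁ 0)| < δ)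
    (hξ : |z 0 - z₁ 0| < ε * |z 1 - z₁ 1 - l * (z 0 - z₁ 0)|) :
    z ∈ sector z₁ ![0, p] ![q, q * l] δ (Ico 0 ε) := by
  set μ := z 1 - z₁ 1 - l * (z 0 - z₁ 0) with hμ
  set ξ := z 0 - z₁ 0 with hξ'
  have hμp : 0 < |μ| := abs_pos.2 hμ0
  rw [mem_sector_iff]
  refine ⟨|μ|, ⟨hμp, hμδ⟩, |ξ| / |μ|, ⟨div_nonneg (abs_nonneg _) hμp.le,
    (div_lt_iff₀ hμp).2 hξ⟩, funext fun i => ?_⟩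
  have h1 : |μ| * (|ξ| / |μ|) = |ξ| := mul_div_cancel₀ _ hμp.ne'
  fin_cases i
  · simp only [bpt, Fin.zero_eta, Matrix.cons_val_zero, zero_add]
    show z 0 = z₁ 0 + |μ| * (|ξ| / |μ| * q)
    rw [← mul_assoc, h1, mul_comm, hq, hξ']; ring
  · simp only [bpt, Fin.mk_one, Matrix.cons_val_one, Matrix.cons_val_zero]
    show z 1 = z₁ 1 + |μ| * (p + |ξ| / |μ| * (q * l))
    have h2 : |μ| * (p + |ξ| / |μ| * (q * l)) = p * |μ| + (q * |ξ|) * l := by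
      rw [mul_add, ← mul_assoc _ (|ξ| / |μ|), h1]; ring
    rw [h2, hp, hq, hμ, hξ']; ring

/-- **Membership in a sector of slope `r`.** A point with `0 < |ξ| < ρ δ` and
`|μ/ξ − r| < ε/ρ` lies in the sector of slope `r`, scale `ρ`, and signs `o = sgn ξ`,
`σ = sgn ξ · sgn (μ/ξ − r)`. -/
theorem mem_hsector (z₁ z : Fin 2 → ℝ) (l r : ℝ) {ρ : ℝ} (δ ε o σ : ℝ) (hρ : 0 < ρ)
    (ho : o * |z 0 - z₁ 0| = z 0 - z₁ 0)
    (hσ : σ * |(z 1 - z₁ 1 - l * (z 0 - z₁ 0)) / (z 0 - z₁ 0) - r| =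
      (z 1 - z₁ 1 - l * (z 0 - z₁ 0)) / (z 0 - z₁ 0) - r)
    (hξ0 : z 0 - z₁ 0 ≠ 0) (hξδ : |z 0 - z₁ 0| < ρ * δ)
    (hr : |(z 1 - z₁ 1 - l * (z 0 - z₁ 0)) / (z 0 - z₁ 0) - r| < ε / ρ) :
    z ∈ sector z₁ ![o * ρ, o * ρ * (l + r)] ![0, o * σ] δ (Ico 0 ε) := by
  set μ := z 1 - z₁ 1 - l * (z 0 - z₁ 0) with hμ
  set ξ := z 0 - z₁ 0 with hξ'
  have hξp : 0 < |ξ| := abs_pos.2 hξ0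
  rw [mem_sector_iff]
  refine ⟨|ξ| / ρ, ⟨div_pos hξp hρ, (div_lt_iff₀ hρ).2 (by rwa [mul_comm] at hξδ)⟩,
    ρ * |μ / ξ - r|, ⟨by positivity, ?_⟩, funext fun i => ?_⟩
  · rwa [← lt_div_iff₀' hρ]
  have h1 : |ξ| / ρ * ρ = |ξ| := div_mul_cancel₀ _ hρ.ne'
  fin_cases i
  · simp only [bpt, Fin.zero_eta, Matrix.cons_val_zero]
    show z 0 = z₁ 0 + |ξ| / ρ * (o * ρ + ρ * |μ / ξ - r| * 0)
    rw [mul_zero, add_zero, mul_comm o, ← mul_assoc, h1, mul_comm, ho, hξ']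
    ring
  · simp only [bpt, Fin.mk_one, Matrix.cons_val_one, Matrix.cons_val_zero]
    show z 1 = z₁ 1 + |ξ| / ρ * (o * ρ * (l + r) + ρ * |μ / ξ - r| * (o * σ))
    have h2 : |ξ| / ρ * (o * ρ * (l + r) + ρ * |μ / ξ - r| * (o * σ)) =
        (o * |ξ|) * (l + r) + (o * |ξ|) * (σ * |μ / ξ - r|) := by
      field_simp
    rw [h2, ho, hσ]
    have h3 : ξ * (μ / ξ - r) = μ - r * ξ := by field_simp
    rw [mul_sub, ← mul_sub, show ξ * (μ / ξ - r) = μ - r * ξ from h3, hμ, hξ']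
    ring

/-- A positive lower bound for finitely many positive reals. -/
theorem exists_pos_le_finset {ι : Type*} (A : Finset ι) (f : ι → ℝ) (hf : ∀ a ∈ A, 0 < f a) :
    ∃ d : ℝ, 0 < d ∧ ∀ a ∈ A, d ≤ f a := by
  classical
  set B := insert (1 : ℝ) (A.image f) with hB
  have hBne : B.Nonempty := ⟨1, Finset.mem_insert_self _ _⟩
  refine ⟨B.min' hBne, (Finset.lt_min'_iff _ _).2 fun b hb => ?_, fun a ha =>
    B.min'_le _ (Finset.mem_insert_of_mem (Finset.mem_image_of_mem f ha))⟩
  rcases Finset.mem_insert.1 hb with rfl | hb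
  · exact one_pos
  · obtain ⟨a, ha, rfl⟩ := Finset.mem_image.1 hb
    exact hf a ha

/-- **Covering lemma.** See the module docstring. -/
theorem cover_nhds (ν : Measure (Fin 2 → ℝ)) (z₁ : Fin 2 → ℝ) (hν : ν {z₁} = 0) (l : ℝ)
    {δV εV : ℝ} (hδV : 0 < δV) (hεV : 0 < εV)
    (hV : ∀ p q : ℝ, |p| = 1 → |q| = 1 → ν (sector z₁ ![0, p] ![q, q * l] δV (Ico 0 εV)) < ∞)
    (hH : ∀ r : ℝ, ∃ ρ > 0, ∃ δ > 0, ∃ ε > 0, ∀ o σ : ℝ, |o| = 1 → |σ| = 1 →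
      ν (sector z₁ ![o * ρ, o * ρ * (l + r)] ![0, σ] δ (Ico 0 ε)) < ∞) :
    ∃ V : Set (Fin 2 → ℝ), IsOpen V ∧ z₁ ∈ V ∧ ν V < ∞ := by
  classical
  choose ρ hρ δ hδ ε hε hfin using hH
  set K : ℝ := εV⁻¹ with hK
  have hK0 : 0 < K := inv_pos.2 hεV
  -- finitely many slopes
  have hcov : Icc (-K) K ⊆ ⋃ r : ℝ, Ioo (r - ε r / ρ r) (r + ε r / ρ r) := fun r _ =>
    mem_iUnion.2 ⟨r, by constructor <;> linarith [div_pos (hε r) (hρ r)]⟩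
  obtain ⟨A, hA⟩ := isCompact_Icc.elim_finite_subcover (fun r : ℝ => Ioo (r - ε r / ρ r)
    (r + ε r / ρ r)) (fun _ => isOpen_Ioo) hcov
  obtain ⟨δH, hδH, hδHa⟩ := exists_pos_le_finset A (fun a => ρ a * δ a)
    fun a _ => mul_pos (hρ a) (hδ a)
  set δ' := min δV δH with hδ'
  have hδ'0 : 0 < δ' := lt_min hδV hδH
  -- the neighbourhood
  set V : Set (Fin 2 → ℝ) := {z | |z 0 - z₁ 0| < δ' ∧ |z 1 - z₁ 1 - l * (z 0 - z₁ 0)| < δ'}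
    with hVdef
  set pm : Finset ℝ := {1, -1} with hpm
  set SV : Set (Fin 2 → ℝ) := ⋃ p ∈ pm, ⋃ q ∈ pm, sector z₁ ![0, p] ![q, q * l] δV (Ico 0 εV)
    with hSV
  set SH : Set (Fin 2 → ℝ) := ⋃ a ∈ A, ⋃ o ∈ pm, ⋃ σ ∈ pm,
    sector z₁ ![o * ρ a, o * ρ a * (l + a)] ![0, σ] (δ a) (Ico 0 (ε a)) with hSH
  have hpm1 : ∀ x ∈ pm, |x| = 1 := fun x hx => by
    rcases Finset.mem_insert.1 hx with rfl | hx
    · exact abs_one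
    · rw [Finset.mem_singleton.1 hx]; simp
  have hSVfin : ν SV < ∞ := by
    refine measure_biUnion_lt_top pm.finite_toSet fun p hp => ?_
    refine measure_biUnion_lt_top pm.finite_toSet fun q hq => ?_
    exact hV p q (hpm1 p hp) (hpm1 q hq)
  have hSHfin : ν SH < ∞ := by
    refine measure_biUnion_lt_top A.finite_toSet fun a _ => ?_
    refine measure_biUnion_lt_top pm.finite_toSet fun o ho => ?_
    refine measure_biUnion_lt_top pm.finite_toSet fun σ hσ => ?_
    exact hfin a o σ (hpm1 o ho) (hpm1 σ hσ)
  have hsub : V ⊆ {z₁} ∪ SV ∪ SH := by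
    intro z hz
    obtain ⟨hzξ, hzμ⟩ := hz
    set ξ := z 0 - z₁ 0 with hξ
    set μ := z 1 - z₁ 1 - l * (z 0 - z₁ 0) with hμ
    by_cases hz1 : z = z₁
    · exact Or.inl (Or.inl hz1)
    have hVmem : μ ≠ 0 → |ξ| < εV * |μ| → z ∈ SV := fun hμ0 hlt => by
      rw [hSV]
      obtain ⟨p, hp, hpμ⟩ := exists_pm_mul_abs μ
      obtain ⟨q, hq, hqξ⟩ := exists_pm_mul_abs ξ
      refine mem_iUnion₂.2 ⟨p, hp, mem_iUnion₂.2 ⟨q, hq, ?_⟩⟩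
      exact mem_vsector z₁ z l δV εV p q hpμ hqξ hμ0 (hzμ.trans_le (min_le_left _ _)) hlt
    by_cases hξ0 : ξ = 0
    · have hμ0 : μ ≠ 0 := by
        intro hμ0
        refine hz1 (funext fun i => ?_)
        fin_cases i
        · exact sub_eq_zero.1 hξ0
        · have : z 1 - z₁ 1 = 0 := by rw [hμ, ← hξ, hξ0, mul_zero, sub_zero] at hμ0; exact hμ0
          exact sub_eq_zero.1 this
      refine Or.inl (Or.inr (hVmem hμ0 ?_))
      rw [hξ0, abs_zero]; exact mul_pos hεV (abs_pos.2 hμ0)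
    by_cases hKμ : K * |ξ| < |μ|
    · have hμ0 : μ ≠ 0 := by
        intro h; rw [h, abs_zero] at hKμ
        exact absurd hKμ (not_lt.2 (by positivity))
      refine Or.inl (Or.inr (hVmem hμ0 ?_))
      calc |ξ| = εV * (K * |ξ|) := by rw [hK]; field_simp
        _ < εV * |μ| := mul_lt_mul_of_pos_left hKμ hεV
    · push Not at hKμ
      have hξp : 0 < |ξ| := abs_pos.2 hξ0
      have hrS : μ / ξ ∈ Icc (-K) K := by
        rw [mem_Icc, ← abs_le, abs_div, div_le_iff₀ hξp]; exact hKμ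
      obtain ⟨a, ha⟩ := mem_iUnion.1 (hA hrS)
      obtain ⟨haA, har⟩ := mem_iUnion.1 ha
      have har' : |μ / ξ - a| < ε a / ρ a := by
        rw [abs_lt]; constructor <;> linarith [har.1, har.2]
      refine Or.inr ?_
      rw [hSH]
      obtain ⟨o, ho, hoξ⟩ := exists_pm_mul_abs ξ
      obtain ⟨σ, hσ, hσμ⟩ := exists_pm_mul_abs (μ / ξ - a)
      refine mem_iUnion₂.2 ⟨a, haA, mem_iUnion₂.2 ⟨o, ho,
        mem_iUnion₂.2 ⟨o * σ, mem_pm_of_abs ?_, ?_⟩⟩⟩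
      · rw [abs_mul, hpm1 o ho, hpm1 σ hσ, one_mul]
      · exact mem_hsector z₁ z l a (δ a) (ε a) o σ (hρ a) hoξ hσμ hξ0
          (hzξ.trans_le ((min_le_right _ _).trans (hδHa a haA))) har'
  refine ⟨V, ?_, ?_, ?_⟩
  · exact (isOpen_lt (by fun_prop) continuous_const).and (isOpen_lt (by fun_prop) continuous_const)
  · show |z₁ 0 - z₁ 0| < δ' ∧ |z₁ 1 - z₁ 1 - l * (z₁ 0 - z₁ 0)| < δ'
    simp [hδ'0]
  · calc ν V ≤ ν ({z₁} ∪ SV ∪ SH) := measure_mono hsub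
      _ < ∞ := measure_union_lt_top (measure_union_lt_top (hν.trans_lt ENNReal.zero_lt_top)
          hSVfin) hSHfin

end SepTwo

/-- **Covering a neighbourhood of a base point by thin sectors** (registered part of
`stub_separateTwoPos_hI`; literal form of `SepTwo.cover_nhds`): a measure on the base plane
without an atom at `z₁`, finite on the four vertical thin sectors at `z₁` and, for every slope
`r` (relative to the direction of slope `l`), on the four thin sectors of slope `r` at some
scale, is finite on a neighbourhood of `z₁`. -/
theorem separateTwo_hiCover (ν : MeasureTheory.Measure (Fin 2 → ℝ)) (z₁ : Fin 2 → ℝ) (hν : ν {z₁} = 0) (l δV εV : ℝ) (hδV : 0 < δV) (hεV : 0 < εV) (hV : ∀ p q : ℝ, |p| = 1 → |q| = 1 → ν ((fun w : Fin 2 → ℝ => z₁ + LinearMap.toContinuousLinearMap (Matrix.toLin' !![(![0, p] : Fin 2 → ℝ) 0, (![q, q * l] : Fin 2 → ℝ) 0; (![0, p] : Fin 2 → ℝ) 1, (![q, q * l] : Fin 2 → ℝ) 1]) w) '' {w : Fin 2 → ℝ | w 0 ∈ Set.Ioo 0 δV ∧ (w 1 - 0) / w 0 ∈ Set.Ico 0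 εV}) < ⊤) (hH : ∀ r : ℝ, ∃ ρ > 0, ∃ δ > 0, ∃ ε > 0, ∀ o σ : ℝ, |o| = 1 → |σ| = 1 → ν ((fun w : Fin 2 → ℝ => z₁ + LinearMap.toContinuousLinearMap (Matrix.toLin' !![(![o * ρ, o * ρ * (l + r)] : Fin 2 → ℝ) 0, (![0, σ] : Fin 2 → ℝ) 0; (![o * ρ, o * ρ * (l + r)] : Fin 2 → ℝ) 1, (![0, σ] : Fin 2 → ℝ) 1]) w) '' {w : Fin 2 → ℝ | w 0 ∈ Set.Ioo 0 δ ∧ (w 1 - 0) / w 0 ∈ Set.Ico 0 ε}) < ⊤) : ∃ V : Set (Fin 2 → ℝ), IsOpen V ∧ z₁ ∈ V ∧ ν V < ⊤ := by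
  exact SepTwo.cover_nhds ν z₁ hν l hδV hεV hV hH

end Summit.KontsevichZagierPeriods.ArrangementNormalForm.JanusBands
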